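import Mathlib
import HarnessLib

/-!
# Integration by parts against a function of bounded variation (Montgomery–Vaughan, App. A)

Topic `Literature/Analysis/FunctionSpaces`; PROVED theorems (no named fact).

For `g` of bounded variation on `[a, b]` and `Φ` continuously differentiable on `[a, b]`,
the Riemann–Stieltjes calculus of [cite: MontgomeryVaughan2007, App. A Thms A.2–A.3, (A.7)]
(Thm A.3: `∫_a^b g dΦ = ∫_a^b g Φ' dx` when `Φ'` is continuous; Thm A.2: integration by parts
`∫_a^b Φ dg = Φ(b) g(b) - Φ(a) g(a) - ∫_a^b g dΦ`; (A.7): `|∫_a^b Φ dg| ≤ M Var_{[a,b]} g` when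
`|Φ| ≤ M` on `[a, b]`) gives the estimate

  `|∫_a^b g(x) Φ'(x) dx - (g(b) Φ(b) - g(a) Φ(a))| ≤ M · Var_{[a,b]} g`.      (∗)

## What is formalised

`abs_integral_mul_deriv_sub_le_mul_variation`: (∗) for real `g` with
`BoundedVariationOn g (Icc a b)`, `Φ` with derivative `ψ` at every point of `[a, b]`, `ψ` continuous
on `[a, b]` and `|Φ| ≤ M` on `[a, b]`; the variation is Mathlib's `eVariationOn g (Icc a b)`.
`abs_integral_mul_deriv_sub_le_of_monotoneOn` is the case of non-decreasing `g`
(bound `M (g b - g a)`).  No Stieltjes integral is introduced: for monotone `g` the interval is cut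
into `N` equal cells, on each cell `∫ g ψ - Δ(g Φ) = ∫ (g - g(u)) ψ - (g(v) - g(u)) Φ(v)` is at most
`(M + sup|ψ| · (b - a)/N) (g(v) - g(u))` in absolute value, the cells telescope, and `N → ∞`;
general `g` is the difference of two monotone functions whose increments add up to the variation
(Jordan decomposition, Mathlib's `LocallyBoundedVariationOn.exists_monotoneOn_sub_monotoneOn'`).
Jumps of `g` are allowed (this is the point of (∗) versus the classical `C¹` integration by parts).

## References

* H. L. Montgomery, R. C. Vaughan, *Multiplicative Number Theory I. Classical Theory*, Cambridge
  Studies in Advanced Mathematics 97, CUP 2007, Appendix A "The Riemann–Stieltjes integral",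
  Theorems A.1–A.3 and eq. (A.7). [cite: MontgomeryVaughan2007, App. A Thms A.2–A.3, (A.7)]

AI-produced formalisation (H21 engines group, seat eng-quad-3, 2026-08-21); no facts, no axioms
beyond Mathlib's, no `sorry`.
-/

noncomputable section

namespace Literature.Analysis.FunctionSpaces

open Set MeasureTheory Filter intervalIntegral
open scoped _root_.Topology ENNReal Interval

/-! ## One cell, monotone integrand -/

/-- On a cell `[u, v] ⊆ [a, b]`, for `g` non-decreasing on `[a, b]`, `Φ' = ψ` on `[a, b]`,
`|ψ| ≤ L` and `|Φ| ≤ M` on `[a, b]`: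
`|∫_u^v g ψ - (g(v) Φ(v) - g(u) Φ(u))| ≤ (M + L (v - u)) (g(v) - g(u))`. [folklore] -/
private theorem cell_bound {a b u v : ℝ} {g Φ ψ : ℝ → ℝ} {M L : ℝ}
    (hg : MonotoneOn g (Icc a b)) (hΦ : ∀ x ∈ Icc a b, HasDerivAt Φ (ψ x) x)
    (hψ : ContinuousOn ψ (Icc a b)) (hL : ∀ x ∈ Icc a b, |ψ x| ≤ L)
    (hM : ∀ x ∈ Icc a b, |Φ x| ≤ M) (hau : a ≤ u) (huv : u ≤ v) (hvb : v ≤ b) :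
    |(∫ x in u..v, g x * ψ x) - (g v * Φ v - g u * Φ u)| ≤ (M + L * (v - u)) * (g v - g u) := by
  have hsub : Icc u v ⊆ Icc a b := Icc_subset_Icc hau hvb
  have hu : u ∈ Icc a b := ⟨hau, huv.trans hvb⟩
  have hv : v ∈ Icc a b := ⟨hau.trans huv, hvb⟩
  have hψc : ContinuousOn ψ (Icc u v) := hψ.mono hsub
  have hψi : IntervalIntegrable ψ volume u v := hψc.intervalIntegrable_of_Icc huv
  have hgi : IntervalIntegrable g volume u v := by
    refine MonotoneOn.intervalIntegrable ?_
    rw [uIcc_of_le huv]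
    exact hg.mono hsub
  have hgψ : IntervalIntegrable (fun x => g x * ψ x) volume u v := by
    refine hgi.mul_continuousOn ?_
    rwa [uIcc_of_le huv]
  have hcψ : IntervalIntegrable (fun x => g u * ψ x) volume u v := hψi.const_mul _
  have hri : IntervalIntegrable (fun x => (g x - g u) * ψ x) volume u v := by
    refine (hgi.sub intervalIntegrable_const).mul_continuousOn ?_
    rwa [uIcc_of_le huv]
  -- `∫_u^v ψ = Φ v - Φ u`
  have hftc : ∫ x in u..v, ψ x = Φ v - Φ u := by
    refine integral_eq_sub_of_hasDerivAt (fun x hx => hΦ x (hsub ?_)) hψi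
    rwa [uIcc_of_le huv] at hx
  -- the remainder `∫_u^v (g - g u) ψ`
  have hrem : |∫ x in u..v, (g x - g u) * ψ x| ≤ (g v - g u) * L * |v - u| := by
    have h := norm_integral_le_of_norm_le_const (a := u) (b := v) (C := (g v - g u) * L)
      (f := fun x => (g x - g u) * ψ x) ?_
    · simpa only [Real.norm_eq_abs] using h
    intro x hx
    rw [uIoc_of_le huv] at hx
    have hx' : x ∈ Icc a b := hsub ⟨hx.1.le, hx.2⟩
    rw [Real.norm_eq_abs, abs_mul]
    have h1 : 0 ≤ g x - g u := sub_nonneg.mpr (hg hu hx' hx.1.le)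
    have h2 : g x - g u ≤ g v - g u := sub_le_sub_right (hg hx' hv hx.2) _
    rw [abs_of_nonneg h1]
    exact mul_le_mul h2 (hL x hx') (abs_nonneg _) (h1.trans h2)
  -- split the integral
  have hsplit : (∫ x in u..v, g x * ψ x) =
      g u * (Φ v - Φ u) + ∫ x in u..v, (g x - g u) * ψ x := by
    have h1 : (∫ x in u..v, g x * ψ x) =
        (∫ x in u..v, g u * ψ x) + ∫ x in u..v, (g x - g u) * ψ x := by
      rw [← integral_add hcψ hri]
      exact integral_congr fun x _ => by ring
    rw [h1, intervalIntegral.integral_const_mul, hftc]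
  have hguv : 0 ≤ g v - g u := sub_nonneg.mpr (hg hu hv huv)
  rw [hsplit]
  have hkey : g u * (Φ v - Φ u) + (∫ x in u..v, (g x - g u) * ψ x) - (g v * Φ v - g u * Φ u) =
      (∫ x in u..v, (g x - g u) * ψ x) - (g v - g u) * Φ v := by ring
  rw [hkey]
  calc |(∫ x in u..v, (g x - g u) * ψ x) - (g v - g u) * Φ v|
      ≤ |∫ x in u..v, (g x - g u) * ψ x| + |(g v - g u) * Φ v| := abs_sub _ _
    _ ≤ (g v - g u) * L * |v - u| + (g v - g u) * M := by
        refine add_le_add hrem ?_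
        rw [abs_mul, abs_of_nonneg hguv]
        exact mul_le_mul_of_nonneg_left (hM v hv) hguv
    _ = (M + L * (v - u)) * (g v - g u) := by
        rw [abs_of_nonneg (sub_nonneg.mpr huv)]
        ring

/-- `x ≤ y + C / N` for every positive integer `N` (with `C ≥ 0`) forces `x ≤ y`. [folklore] -/
private theorem le_of_forall_le_add_div_nat {x y C : ℝ} (hC : 0 ≤ C)
    (h : ∀ N : ℕ, 0 < N → x ≤ y + C / N) : x ≤ y := by
  refine le_of_forall_pos_le_add fun ε hε => ?_
  obtain ⟨N, hN⟩ := exists_nat_gt (C / ε)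
  have hN0 : 0 < N := by
    have : (0 : ℝ) < N := (div_nonneg hC hε.le).trans_lt hN
    exact_mod_cast this
  have hNr : (0 : ℝ) < N := by exact_mod_cast hN0
  have hCN : C / N ≤ ε := by
    rw [div_le_iff₀ hNr]
    rw [div_lt_iff₀ hε] at hN
    linarith
  linarith [h N hN0]

/-! ## Monotone integrand -/

/-- **Integration by parts against a non-decreasing function** (the monotone case of
Montgomery–Vaughan, App. A, Thms A.2–A.3 with (A.7)): if `g` is non-decreasing on `[a, b]`,
`Φ` has derivative `ψ` at every point of `[a, b]`, `ψ` is continuous on `[a, b]` and `|Φ| ≤ M`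
there, then `|∫_a^b g ψ - (g(b) Φ(b) - g(a) Φ(a))| ≤ M (g(b) - g(a))`
(`= M Var_{[a,b]} g`; jumps of `g` allowed). [cite: MontgomeryVaughan2007, App. A Thms A.2–A.3, (A.7)] -/
theorem abs_integral_mul_deriv_sub_le_of_monotoneOn {a b : ℝ} (hab : a ≤ b) {g Φ ψ : ℝ → ℝ}
    {M : ℝ} (hg : MonotoneOn g (Icc a b)) (hΦ : ∀ x ∈ Icc a b, HasDerivAt Φ (ψ x) x)
    (hψ : ContinuousOn ψ (Icc a b)) (hM : ∀ x ∈ Icc a b, |Φ x| ≤ M) :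
    |(∫ x in a..b, g x * ψ x) - (g b * Φ b - g a * Φ a)| ≤ M * (g b - g a) := by
  -- a bound `L ≥ 0` for `|ψ|` on `[a, b]`
  obtain ⟨L₀, hL₀⟩ := isCompact_Icc.exists_bound_of_continuousOn hψ
  set L := max L₀ 0 with hLdef
  have hL : ∀ x ∈ Icc a b, |ψ x| ≤ L := fun x hx =>
    (Real.norm_eq_abs _ ▸ hL₀ x hx).trans (le_max_left _ _)
  have hL0 : 0 ≤ L := le_max_right _ _
  have ha : a ∈ Icc a b := ⟨le_rfl, hab⟩
  have hb : b ∈ Icc a b := ⟨hab, le_rfl⟩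
  have hD : 0 ≤ g b - g a := sub_nonneg.mpr (hg ha hb hab)
  -- for every `N ≥ 1`: the bound with the extra term `L (b - a) (g b - g a) / N`
  refine le_of_forall_le_add_div_nat (C := L * (b - a) * (g b - g a)) (by
    have := sub_nonneg.mpr hab; positivity) fun N hN => ?_
  have hNr : (0 : ℝ) < N := by exact_mod_cast hN
  -- the uniform partition
  set h : ℝ := (b - a) / N with hh
  have hh0 : 0 ≤ h := div_nonneg (sub_nonneg.mpr hab) hNr.le
  set x : ℕ → ℝ := fun i => a + i * h with hx
  have hx0 : x 0 = a := by simp [hx]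
  have hxN : x N = b := by
    simp only [hx, hh]
    field_simp
    ring
  have hxmono : Monotone x := fun i j hij => by
    simp only [hx]
    have : (i : ℝ) ≤ j := by exact_mod_cast hij
    nlinarith
  have hxsucc : ∀ i, x (i + 1) - x i = h := fun i => by
    simp only [hx]
    push_cast
    ring
  have hxa : ∀ i, a ≤ x i := fun i => by
    rw [← hx0]
    exact hxmono (Nat.zero_le i)
  have hxb : ∀ i ≤ N, x i ≤ b := fun i hi => by
    rw [← hxN]
    exact hxmono hi
  -- per-cell bounds
  have hcell : ∀ i < N,
      |(∫ t in x i..x (i + 1), g t * ψ t) - (g (x (i + 1)) * Φ (x (i + 1)) - g (x i) * Φ (x i))| ≤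
        (M + L * h) * (g (x (i + 1)) - g (x i)) := by
    intro i hi
    have := cell_bound hg hΦ hψ hL hM (hxa i) (hxmono (Nat.le_succ i)) (hxb (i + 1) hi)
    rwa [hxsucc i] at this
  -- integrability on each cell (for additivity)
  have hint : ∀ i < N, IntervalIntegrable (fun t => g t * ψ t) volume (x i) (x (i + 1)) := by
    intro i hi
    have hsub : Icc (x i) (x (i + 1)) ⊆ Icc a b := Icc_subset_Icc (hxa i) (hxb (i + 1) hi)
    have hle : x i ≤ x (i + 1) := hxmono (Nat.le_succ i)
    refine (MonotoneOn.intervalIntegrable ?_).mul_continuousOn ?_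
    · rw [uIcc_of_le hle]; exact hg.mono hsub
    · rw [uIcc_of_le hle]; exact hψ.mono hsub
  have hsumI : ∑ i ∈ Finset.range N, ∫ t in x i..x (i + 1), g t * ψ t =
      ∫ t in a..b, g t * ψ t := by
    rw [sum_integral_adjacent_intervals hint, hx0, hxN]
  have hsumB : ∑ i ∈ Finset.range N, (g (x (i + 1)) * Φ (x (i + 1)) - g (x i) * Φ (x i)) =
      g b * Φ b - g a * Φ a := by
    rw [Finset.sum_range_sub (fun i => g (x i) * Φ (x i)), hx0, hxN]
  have hsumD : ∑ i ∈ Finset.range N, (g (x (i + 1)) - g (x i)) = g b - g a := by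
    rw [Finset.sum_range_sub (fun i => g (x i)), hx0, hxN]
  -- assemble
  have hE : (∫ t in a..b, g t * ψ t) - (g b * Φ b - g a * Φ a) =
      ∑ i ∈ Finset.range N, ((∫ t in x i..x (i + 1), g t * ψ t) -
        (g (x (i + 1)) * Φ (x (i + 1)) - g (x i) * Φ (x i))) := by
    rw [Finset.sum_sub_distrib, hsumI, hsumB]
  calc |(∫ t in a..b, g t * ψ t) - (g b * Φ b - g a * Φ a)|
      = |∑ i ∈ Finset.range N, ((∫ t in x i..x (i + 1), g t * ψ t) -
          (g (x (i + 1)) * Φ (x (i + 1)) - g (x i) * Φ (x i)))| := by rw [hE]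
    _ ≤ ∑ i ∈ Finset.range N, |(∫ t in x i..x (i + 1), g t * ψ t) -
          (g (x (i + 1)) * Φ (x (i + 1)) - g (x i) * Φ (x i))| := Finset.abs_sum_le_sum_abs _ _
    _ ≤ ∑ i ∈ Finset.range N, (M + L * h) * (g (x (i + 1)) - g (x i)) :=
        Finset.sum_le_sum fun i hi => hcell i (Finset.mem_range.mp hi)
    _ = (M + L * h) * (g b - g a) := by rw [← Finset.mul_sum, hsumD]
    _ = M * (g b - g a) + L * (b - a) * (g b - g a) / N := by
        simp only [hh]
        field_simp

/-! ## Integrand of bounded variation -/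

/-- **Integration by parts against a function of bounded variation** (Montgomery–Vaughan 2007,
App. A: Thm A.3 `∫ g dΦ = ∫ g Φ'`, Thm A.2 `∫ Φ dg = [Φ g]_a^b - ∫ g dΦ`, and (A.7)
`|∫ Φ dg| ≤ M Var_{[a,b]} g`): if `g : ℝ → ℝ` has bounded variation on `[a, b]`, `Φ` has
derivative `ψ` at every point of `[a, b]`, `ψ` is continuous on `[a, b]` and `|Φ| ≤ M` there, then
`|∫_a^b g(x) ψ(x) dx - (g(b) Φ(b) - g(a) Φ(a))| ≤ M · Var_{[a,b]} g`
(`Var = (eVariationOn g (Icc a b)).toReal`; jumps of `g` are allowed).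
[cite: MontgomeryVaughan2007, App. A Thms A.2–A.3, (A.7)] -/
theorem abs_integral_mul_deriv_sub_le_mul_variation {a b : ℝ} (hab : a ≤ b) {g Φ ψ : ℝ → ℝ}
    {M : ℝ} (hg : BoundedVariationOn g (Icc a b)) (hΦ : ∀ x ∈ Icc a b, HasDerivAt Φ (ψ x) x)
    (hψ : ContinuousOn ψ (Icc a b)) (hM : ∀ x ∈ Icc a b, |Φ x| ≤ M) :
    |(∫ x in a..b, g x * ψ x) - (g b * Φ b - g a * Φ a)| ≤
      M * (eVariationOn g (Icc a b)).toReal := by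
  have ha : a ∈ Icc a b := ⟨le_rfl, hab⟩
  have hb : b ∈ Icc a b := ⟨hab, le_rfl⟩
  obtain ⟨p, q, hp, hq, hpq, hvar⟩ :=
    hg.locallyBoundedVariationOn.exists_monotoneOn_sub_monotoneOn'
  -- the increments of `p` and `q` add up to the variation
  have hV : (p b - p a) + (q b - q a) = (eVariationOn g (Icc a b)).toReal := by
    rw [hvar a ha b hb, variationOnFromTo.eq_of_le _ _ hab, inter_self]
  have hψab : ContinuousOn ψ (uIcc a b) := by rwa [uIcc_of_le hab]
  have hpi : IntervalIntegrable (fun x => p x * ψ x) volume a b :=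
    (MonotoneOn.intervalIntegrable (by rwa [uIcc_of_le hab])).mul_continuousOn hψab
  have hqi : IntervalIntegrable (fun x => q x * ψ x) volume a b :=
    (MonotoneOn.intervalIntegrable (by rwa [uIcc_of_le hab])).mul_continuousOn hψab
  have hgx : ∀ x, g x = p x - q x := fun x => by rw [hpq]; rfl
  have hsplit : (∫ x in a..b, g x * ψ x) = (∫ x in a..b, p x * ψ x) - ∫ x in a..b, q x * ψ x := by
    rw [← integral_sub hpi hqi]
    congr 1
    ext x
    rw [hgx]
    ring
  have hP := abs_integral_mul_deriv_sub_le_of_monotoneOn hab hp hΦ hψ hM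
  have hQ := abs_integral_mul_deriv_sub_le_of_monotoneOn hab hq hΦ hψ hM
  have hkey : (∫ x in a..b, g x * ψ x) - (g b * Φ b - g a * Φ a) =
      ((∫ x in a..b, p x * ψ x) - (p b * Φ b - p a * Φ a)) -
        ((∫ x in a..b, q x * ψ x) - (q b * Φ b - q a * Φ a)) := by
    rw [hsplit, hgx a, hgx b]
    ring
  rw [hkey, ← hV, mul_add]
  exact (abs_sub _ _).trans (add_le_add hP hQ)

/-- The same estimate with `M = sup_{[a,b]} |Φ|` replaced by any bound, in the frequently used
special case `Φ(a) = Φ(b) = 0` (e.g. `Φ = sin(j·)/j` on `[0, π]`):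
`|∫_a^b g ψ| ≤ M · Var_{[a,b]} g`. [cite: MontgomeryVaughan2007, App. A Thms A.2–A.3, (A.7)] -/
theorem abs_integral_mul_deriv_le_mul_variation {a b : ℝ} (hab : a ≤ b) {g Φ ψ : ℝ → ℝ}
    {M : ℝ} (hg : BoundedVariationOn g (Icc a b)) (hΦ : ∀ x ∈ Icc a b, HasDerivAt Φ (ψ x) x)
    (hψ : ContinuousOn ψ (Icc a b)) (hM : ∀ x ∈ Icc a b, |Φ x| ≤ M) (hΦa : Φ a = 0)
    (hΦb : Φ b = 0) :
    |∫ x in a..b, g x * ψ x| ≤ M * (eVariationOn g (Icc a b)).toReal := by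
  have h := abs_integral_mul_deriv_sub_le_mul_variation hab hg hΦ hψ hM
  rwa [hΦa, hΦb, mul_zero, mul_zero, sub_zero, sub_zero] at h

end Literature.Analysis.FunctionSpaces

end
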